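import Literature.Geometry.Riemannian.ChangGurskyYangRegularity
import Literature.Geometry.Lorentzian.MetricNormSq
import HarnessLib

/-!
# `|Hess f|²_g = |Ric|²_g + 1 − R` pointwise on a four-dimensional gradient shrinker
(stub `stub_normSqHessian` of line `cgy-variance-pivot`, crux `EntropyRung.CompactShrinkerGap`,
item stmt-SmoothPoincare4-10870)

For a Riemannian metric `g` (Levi-Civita connection) on a `4`-manifold `M` and a function `f`
with `Ric + Hess f = g/2` pointwise (gradient shrinking soliton), at every point `x ∈ M` the
metric square norms (`normSq`, the contraction `T_{ij}T^{ij}`) satisfy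
`|Hess f|²_g(x) = |Ric|²_g(x) + 1 − R(x)`.
Informally: `Hess f = ½g − Ric` as bilinear forms, so
`|Hess f|² = ¼|g|² − ⟨g, Ric⟩_g + |Ric|² = ¼·4 − R + |Ric|²` (`|g|²_g = dim M = 4`,
`⟨g, Ric⟩_g = tr_g Ric = R`); this is the pointwise dictionary entry behind
`∫|Hess f|² dV = ½∫(R − 2)² dV` (Cheng–Ribeiro–Zhou, Lemma 1; Cao–Zhu, (3.6)–(3.7)).

Proof (pure fibrewise linear algebra, no differentiation): pick a `g_x`-orthonormal basis
`b : Fin 4 → T_x M` (`exists_basis_isOrthonormalFrame`, `finrank ℝ ℝ⁴ = 4`); the frame formula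
`normSq_eq_sum_sq` gives `|T|² = Σᵢⱼ T(bⱼ, bᵢ)²` for `T = Hess f` and `T = Ric`
(`g(bᵢ, bᵢ) = 1`); substitute `Hess f(bⱼ, bᵢ) = ½δⱼᵢ − Ric(bⱼ, bᵢ)` (soliton equation and
`IsOrthonormalFrame.val_eq_ite`), expand the square, collapse the Kronecker sums
(`Finset.sum_ite_eq'`) and use `Σᵢ Ric(bᵢ, bᵢ) = R`
(`IsOrthonormalFrame.sum_ricci_eq_scalarCurvature`). Everything used is proved in tree; no
definition, no named fact. Check: round `S⁴(√6)`, `f ≡ 2`: `Ric = g/2`, `|Ric|² = 1`, `R = 2`,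
`Hess f = 0`: `0 = 1 + 1 − 2`.

References: X. Cheng, E. Ribeiro Jr, D. Zhou, arXiv:2203.14916, Lemma 1 [ChengRibeiroZhou2022];
H.-D. Cao, M. Zhu, arXiv:1008.0842, (3.6)–(3.7) [CaoZhu2010]; B. O'Neill, *Semi-Riemannian
geometry* (1983), Ch. 3, pp. 60–61 (metric contraction in a frame) [ONeill1983].
-/

noncomputable section

-- the registered namespace `Summit.SmoothPoincare4.SmoothPoincare4.Theorems` repeats a component
set_option linter.dupNamespace false

open Bundle Set Function Filter Module MeasureTheory
open scoped Manifold ContDiff Topology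

namespace Summit.SmoothPoincare4.SmoothPoincare4.Theorems

open Literature.Geometry Literature.Geometry.Lorentzian Literature.Geometry.Riemannian
  Literature.Geometry.Lorentzian.PseudoRiemannianMetric

/-- **STUB `stub_normSqHessian` of line `cgy-variance-pivot` — the pointwise Hessian/Ricci norm
identity of a gradient shrinker.** For a Riemannian `g` (Levi-Civita) on a `4`-manifold and `f`
with `Ric + Hess f = g/2` pointwise: `|Hess f|²_g = |Ric|²_g + 1 − R` at every point
(`Hess f = ½g − Ric` as bilinear forms, `|½g|² = ¼·dim = 1`, `⟨g, Ric⟩_g = tr_g Ric = R`; the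
metric square norm `normSq = T_{ij}T^{ij}` is computed in a `g_x`-orthonormal basis by
`normSq_eq_sum_sq`, `exists_basis_isOrthonormalFrame`,
`IsOrthonormalFrame.sum_ricci_eq_scalarCurvature`). Check: round `S⁴(√6)`, `f ≡ 2`:
`0 = 1 + 1 − 2`. [cite: CaoZhu2010, (3.6)–(3.7)] [cite: ChengRibeiroZhou2022, Lemma 1] -/
theorem stub_normSqHessian :
    ∀ (M : Type) [TopologicalSpace M] [T2Space M] [SecondCountableTopology M]
      [ChartedSpace (EuclideanSpace ℝ (Fin 4)) M] [IsManifold (𝓡 4) ∞ M]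
      (g : Literature.Geometry.Lorentzian.PseudoRiemannianMetric (𝓡 4) ∞ (EuclideanSpace ℝ (Fin 4))
        (TangentSpace (𝓡 4) : M → Type _)) [g.HasLeviCivita] (f : M → ℝ), g.IsRiemannian →
      (∀ (x : M) (X Y : TangentSpace (𝓡 4) x),
        g.ricci x X Y + g.hessian f x X Y = (1 / 2 : ℝ) * g.val x X Y) →
      ∀ x : M, g.normSq x (g.hessian f x) = g.normSq x (g.ricci x) + 1 - g.scalarCurvature x := by
  intro M _ _ _ _ _ g _ f hg hsol x
  have hE : finrank ℝ (EuclideanSpace ℝ (Fin 4)) = 4 := finrank_euclideanSpace_fin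
  -- a `g_x`-orthonormal basis of `T_x M`
  obtain ⟨b, hb⟩ := g.exists_basis_isOrthonormalFrame (x := x) (fun v hv ↦ hg x v hv) hE
  have hO : (g.toBilinForm x).IsOrthoᵢ b := fun i j hij ↦ hb.2 i j hij
  have hc : ∀ i, g.val x (b i) (b i) ≠ 0 := fun i ↦ by
    rw [hb.1 i]
    exact one_ne_zero
  -- the soliton equation on the frame: `Hess f(bⱼ, bᵢ) = ½δⱼᵢ − Ric(bⱼ, bᵢ)`
  have hH : ∀ i j, g.hessian f x (b j) (b i) =
      1 / 2 * (if j = i then 1 else 0) - g.ricci x (b j) (b i) := fun i j ↦ by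
    rw [← hb.val_eq_ite g j i]
    linarith [hsol x (b j) (b i)]
  -- expand the square: `(½δ − r)² = r² + δ(¼ − r)`
  have hsq : ∀ i j, (1 / 2 * (if j = i then 1 else 0 : ℝ) - g.ricci x (b j) (b i)) ^ 2 =
      g.ricci x (b j) (b i) ^ 2 + (if j = i then 1 / 4 - g.ricci x (b j) (b i) else 0) := by
    intro i j
    split_ifs <;> ring
  rw [g.normSq_eq_sum_sq x b hO hc (g.hessian f x), g.normSq_eq_sum_sq x b hO hc (g.ricci x),
    ← hb.sum_ricci_eq_scalarCurvature g hE]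
  simp only [hb.1, mul_one, div_one, hH, hsq, Finset.sum_add_distrib, Finset.sum_ite_eq',
    Finset.mem_univ, if_true, Finset.sum_sub_distrib, Finset.sum_const, Finset.card_univ,
    Fintype.card_fin, nsmul_eq_mul]
  norm_num
  ring

end Summit.SmoothPoincare4.SmoothPoincare4.Theorems

end
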